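import Literature.MathematicalPhysics.QuantumFieldTheory.Balaban1983to89.B9Eq3130GtildeGradRowClosed
import Literature.MathematicalPhysics.QuantumFieldTheory.Balaban1983to89.B9Eq3130GtildeTransferTowerDifference

/-!
# `Balaban1983to89.B9Eq3130GtildeMinusG1kGradRowsClosed` — T. Bałaban, *Propagators for lattice gauge theories in a background field*, Commun. Math. Phys. **99** (1985) 389–434
# [Balaban1985BackgroundPropagators] (3.130)–(3.131) pp. 421–422 (*«G = G₀(I − Δ′_πG₀)⁻¹ = Σ G₀(Δ′_πG₀)ⁿ»*, p. 422 l. 1–6: the series minus its first term is `O(α₀)`), (3.117) p. 419,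
# (3.36) p. 396, Thm 3.13 p. 426: **THE SLOT DIFFERENCE `G̃_k − G₁,k` (print's operator (3.122) minus the chain's (3.26), SAME background) HAS VALUE, DIVERGENCE AND
# SLICE∕COVARIANT-GRADIENT ROWS WITH THE SMALL FACTOR `α`, ∃-FIRST, HEIGHT-FREE** — the OWNER's (T4B) `B9Eq3130GtildeGradRowClosed.exists_local_rows_G1kPi` VERBATIM (binder block,
# suppliers, constants) with gen 101's difference transfer `B9Eq3130GtildeTransferTowerDifference.letter_transfer_tower_sub` in place of (T4A): for `f` supported over one unit block `v`
# with `‖f‖_∞ ≤ F`: `‖((G̃_k − G₁,k)f)(b)‖`, `‖(D*_U(G̃_k − G₁,k)f)(y)‖`, `‖(D_U((G̃_k − G₁,k)f)_μ)(b)‖`, `‖(∇_U(G̃_k − G₁,k)f)(b,μ)‖ ≤ α·B·e^{−δ·d}·F` — the GRADIENT member that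
# ne9-leaf-05's (K79) `B9Eq3130GtildeMinusG1kRowsClosed` (value + divergence, factor `j₀`, left-grouped road) does not give and that the π-side of ROUTE (J′) needs
# (`H̃_k − H_k`, `𝔊̃_k − 𝔊_k` gradient letters ⇒ the lattice-free (117) defects of the chart actually instantiated by `Support/NE9CurChartTowerPi…`)

statement-level skeleton of published theorems with citation tags; proofs where landed; nothing here is a claim about the Yang–Mills mass gap

CITATION HEADER (lean-in-tree rule).  Audit cell `pub-balaban`, sub-cell `t4`, BINDER row NE9; filed by NE9 crux-team LEAF PROVER 01 (`b2b-balaban-t4-ne9-formalise-leaf-01`, gen 101;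
ROUTE (J′), π-side; bears_on: R4/N22).  Composition BY NAME, exactly as (T4B): (K64) `exists_local_letter_G1k`, (DGK) `exists_divergence_row_G1k`, (E2) `exists_local_gradLetter_G1k`,
ne9-leaf-05's `exists_local_letters_GpOfUk_RofUk`, (K70) `exists_local_gradLetter_GpRk`, ne9-leaf-03's (T2) `exists_local_gradLetter_RkGp`, (K75) `local_hessOp_covDerivL2K_tower` ∕
`local_covDivL2K_hessOp_tower`, `norm_covGrad_apply_le_of_slice`; the transfer is gen 101's `letter_transfer_tower_sub`.  Source READ first-hand in the held text layer
`paper:balaban1985-cmp99-background-propagators` (journal page = PDF page + 388) pp. 396, 419–422, 426.  NOTHING of print's proofs is reproduced: [folklore] composition of landed letters.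

WHAT IS PROVED (sorry-free; proof lane — 0 `def`; [folklore]).
* **`exists_local_rows_G1kPi_sub_G1k`** — `∃ α₁ B δ, 0 < α₁ ∧ 0 ≤ B ∧ 0 < δ ∧ ∀ ⟨(T4B)'s binder block VERBATIM: … hpos' hpos hposπ (hc₀ : c₀ = η^d) (hJ : ‖J‖ ≤ α) v f F hfv hfF μ b y⟩`:
  the four rows of `G̃_kf − G₁,kf` (`G1LatticeK hposπ f − G1k … hpos f`) listed above, each `≤ α·B·e^{−δ·d_m(·, v)}·F` (value at `Π(b₋)`, divergence at `Π(y)`, the two gradient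
  readings at `Π(b₊)`); `δ = κ₀∕8`, `B = 2·Q·K′·B_Σ·K′` with (T4B)'s `Q`, `B_Σ = B₀ + B₁ + B_X`, `K′ = K_d(κ₀∕8)`, `α₁` (T4B)'s (so that `αQK′² ≤ ½`).
HONEST SCOPE.  `hpos′`, `hpos`, `hposπ`, the windows, E162's data, `c₀ = η^d`, `‖J‖ ≤ α` stay HYPOTHESES (as in (T4B)); constants crude; nothing of [B9] (3.36) ∕ (3.130)–(3.133) ∕ Thm 3.3 ∕
3.13 asserted, valued or discharged; «NE9 ⇐ the named binders»; NE9 NOT PRINTED ∕ NOT PROVED; row WALLED ON A MODEL (O-NE9-1; #5 UNRULED); spine PROVED 0∕9; rung (B)+1 on a finite T⁴ —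
NOT infinite volume, NOT mass gap, NOT BetaPertH, NOT Clay.  HONEST DEPENDENCY: continuum YM on T⁴ ⇐ BetaPertH ∧ nine spine estimates (0/9 proved); BetaPertH ⇐ (D1) ∧ (D4) ∧ CAP+tail;
G-an2-4 gates asym, D1 and NE2/3/4.  NEW file importing (T4B) (for its suppliers' imports) and gen 101's difference transfer; nothing modified.  Net new unproved facts: 0.
-/

noncomputable section

set_option autoImplicit false

open scoped InnerProductSpace ComplexConjugate BigOperators

namespace Literature.MathematicalPhysics.QuantumFieldTheory.Balaban1983to89.B9Eq3130GtildeMinusG1kGradRowsClosed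

open B4Sect5Torus (TSite tdist tdist_nonneg)
open B4Sect5Proof (latticeConst latticeConst_nonneg)
open B9SectCLatticeCarrier (Bond bpos btgt unshift)
open B9Eq311L2Pairing (WL2)
open B9Eq33CovDerivVector (covGrad)
open B9Eq319QprimeTorus (blockCoord)
open B7Prop1Explicit (U1 Wcx boxVec)
open B11Eq103H1Complex (SiteL2K BondL2K covDerivL2K covDivL2K G1LatticeK)
open B9Eq310DeltaPrime (plaqHolU)
open B9Eq310HessianOperator (adTransportW hessOp)
open B9Eq310HessianHermitian (adTransportW_adjoint)
open B9Eq315QTorus (perCfg cornerSite)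
open B9Eq315QTower (towerP UlevOf)
open B9Eq316TowerFlatIsOneStep (towerP_eq_fineP_pow siteCast)
open B9Eq326OperatorTower (laplaceAk G1k RofUk)
open B9Eq324DeltaPrimeATower (laplacePrimeAk GpOfUk)
open B9Eq3119DeltaPiTower (laplaceAkPi)
open B9Eq3130GtildeTransferTowerDifference (letter_transfer_tower_sub)
open B9Eq326LocalPartTowerSliceGradientRow (norm_covGrad_apply_le_of_slice)
open B9Eq326G1kSupRowClosed (exists_local_letter_G1k)
open B9Eq326G1kDivergenceRowClosed (exists_divergence_row_G1k)
open B9Eq326G1kSliceGradRowClosed (exists_local_gradLetter_G1k)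
open B9Eq3152GreenPrimeProjGradRowClosed (exists_local_gradLetter_GpRk)
open B9Eq3152ProjGreenPrimeGradRowClosed (exists_local_gradLetter_RkGp)
open B9Eq325RofUkSupRowClosed (exists_local_letters_GpOfUk_RofUk)
open B9Eq3117GaugeModeStencilLettersTower (local_hessOp_covDerivL2K_tower local_covDivL2K_hessOp_tower)

/-! ## §0 Bookkeeping -/

/-- Weakening a letter value: `B·e^{−κD}·F ≤ B′·e^{−κ′D}·F` for `0 ≤ B ≤ B′`, `κ′ ≤ κ`, `0 ≤ D`, `0 ≤ F`. [folklore] -/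
private theorem weaken {B B' κ κ' D F : ℝ} (hB : 0 ≤ B) (hBB : B ≤ B') (hκ : κ' ≤ κ) (hD : 0 ≤ D) (hF : 0 ≤ F) :
    B * Real.exp (-(κ * D)) * F ≤ B' * Real.exp (-(κ' * D)) * F := by
  refine mul_le_mul_of_nonneg_right ?_ hF
  refine mul_le_mul hBB (Real.exp_le_exp.2 ?_) (Real.exp_nonneg _) (hB.trans hBB)
  nlinarith [mul_le_mul_of_nonneg_right hκ hD]

/-! ## §1 BEFORE THE HEIGHT: the value, divergence and gradient rows of the slot difference `G̃_k − G₁,k`, `∃ (α₁, B, δ)` first -/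

section AllHeights

variable {d : ℕ} (hd : 1 ≤ d) (L : ℕ) [NeZero L] (hL : 1 ≤ L) (hL3 : 3 ≤ L)
  {𝔸 : Type*} [NormedRing 𝔸] [NormedAlgebra ℂ 𝔸] [CompleteSpace 𝔸] [NormOneClass 𝔸] [StarRing 𝔸] [NormedStarGroup 𝔸] [StarModule ℂ 𝔸]
  {W : Type*} [NormedAddCommGroup W] [InnerProductSpace ℂ W] [FiniteDimensional ℂ W] (φ : W ≃ₗ[ℂ] 𝔸)
  {Mφ Mφ' : ℝ} (hMφ : 0 ≤ Mφ) (hMφ' : 0 ≤ Mφ') (hφ : ∀ w, ‖φ w‖ ≤ Mφ * ‖w‖) (hφ' : ∀ X, ‖φ.symm X‖ ≤ Mφ' * ‖X‖) (hstar : ∀ X : 𝔸, ‖star X‖ ≤ ‖X‖)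
  {a : ℝ} (ha : 0 < a) {a' : ℝ} (ha' : 0 < a') {ϱ : ℝ} (hϱ0 : 0 ≤ ϱ) (hϱ1 : ϱ < 1)
  (τ : 𝔸 →ₗ[ℂ] ℂ) {Cτ : ℝ} (hτ : ∀ X, ‖τ X‖ ≤ Cτ * ‖X‖) (hCτ : 0 ≤ Cτ) {Mτ : ℝ} (hτm : ∀ X Y : 𝔸, ‖τ (X * Y)‖ ≤ Mτ * ‖X‖ * ‖Y‖) (hMτ : 0 ≤ Mτ)
  {ρw : ℝ} (hρw : 0 ≤ ρw)
  (hτ₁ : ∀ X : 𝔸, τ (star X) = conj (τ X)) (hτ₂ : ∀ X Y : 𝔸, τ (X * Y) = τ (Y * X)) (hφτ : ∀ X Y : 𝔸, ⟪φ.symm X, φ.symm Y⟫_ℂ = τ (star X * Y))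
  (AQ : ℝ)

/-- `1∕(1 − t) ≤ 2` for `t ≤ 1∕2`. [folklore] -/
private theorem one_div_one_sub_le_two {t : ℝ} (ht : t ≤ 1 / 2) : 1 / (1 - t) ≤ 2 := by
  rw [div_le_iff₀ (by linarith)]; linarith

set_option maxHeartbeats 400000 in -- six `∃`-first suppliers with ≈ 40 binders each, §1 applied three times: the defeq assembly exceeds the default budget
include hd hL hL3 hMφ hMφ' hφ hφ' hstar ha ha' hϱ0 hϱ1 hτ hCτ hτm hMτ hρw hτ₁ hτ₂ hφτ in
/-- **THE SLOT DIFFERENCE `G̃_k − G₁,k` HAS VALUE, DIVERGENCE AND SLICE∕COVARIANT-GRADIENT ROWS WITH THE SMALL FACTOR `α`, ∃-FIRST** — (T4B)'s binder block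
VERBATIM; the four rows of `G1LatticeK hposπ f − G1k … hpos f`, each `≤ α·B·e^{−δ·d}·F`; proof = (T4B)'s with `letter_transfer_tower_sub` (the `q`-carrying summand only,
`q = α·Q`, `1∕(1 − qK′²) ≤ 2`). [cite: Balaban1985BackgroundPropagators, (3.130)–(3.131) pp.421–422, Thm 3.13 p.426, Thm 3.3 p.399, Thm 3.1 (3.42) p.397, (3.117) p.419,
(3.36) p.396, (3.122) p.420; Balaban1985Variational, (115) p.294, (117) p.295] -/
theorem exists_local_rows_G1kPi_sub_G1k :
    ∃ α₁ B δ : ℝ, 0 < α₁ ∧ 0 ≤ B ∧ 0 < δ ∧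
      ∀ (n : ℕ) (η : ℝ) (_hηL : η * (L : ℝ) ^ (n + 1) = 1) (c₀ c₁ : ℝ) [Fact (0 < c₀)] [Fact (0 < c₁)]
        (_hw : c₀ * ((L : ℝ) ^ (n + 1)) ^ d = c₁) (_hρ : |η| ^ d / c₀ ≤ ρw) (m : Fin d → ℕ) [∀ i, NeZero (m i)] (_hm : ∀ i, 1 ≤ m i)
        (U : Bond d (towerP L m (n + 1)) → 𝔸ˣ) (αU : ℕ → ℝ) (_hα0 : ∀ j, 0 ≤ αU j) (hα1 : ∀ j, αU j ≤ 1 / 64)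
        (hU1 : ∀ (j : ℕ) (x : B7Prop1Explicit.Site d) (k : Fin d), perCfg (towerP L m (j + 1)) (UlevOf L m (n + 1) U j) x k ∈ U1 𝔸)
        (hreg : ∀ (j : ℕ) (y : TSite d (towerP L m j)) (k : Fin d) (ρ' : Fin d → Fin L),
          ‖((Wcx L (perCfg (towerP L m (j + 1)) (UlevOf L m (n + 1) U j)) (cornerSite L y) k (boxVec L ρ') : 𝔸ˣ) : 𝔸) - 1‖ ≤ αU j)
        (εU : ℕ → ℝ) (_hεU : ∀ j, 0 ≤ εU j) (_hUε : ∀ (j : ℕ) (b : Bond d (towerP L m (j + 1))), ‖(UlevOf L m (n + 1) U j b : 𝔸) - 1‖ ≤ εU j)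
        (_hLb : ∀ (j : ℕ) (b : Bond d (towerP L m (j + 1))), UlevOf L m (n + 1) U j b ∈ U1 𝔸)
        (α : ℝ) (_hα : 0 ≤ α) (_hαle : α ≤ α₁)
        (hUst : ∀ b, star (U b : 𝔸) = (((U b)⁻¹ : 𝔸ˣ) : 𝔸)) (_hUb : ∀ b, U b ∈ U1 𝔸) (_hUη : ∀ b, ‖(U b : 𝔸) - 1‖ ≤ α * η)
        (_hpl : ∀ p : B9SectCLatticeCarrier.Plaq d (towerP L m (n + 1)), ‖(plaqHolU U p : 𝔸) - 1‖ ≤ α * η ^ 2)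
        (_hUgrad : ∀ (x : TSite d (towerP L m (n + 1))) (μ : Fin d), ‖(U (x, μ) : 𝔸) - U (unshift μ x, μ)‖ ≤ α * η ^ 2)
        (_hRlev : ∀ (j : ℕ) (b : Bond d (towerP L m (j + 1))) (w : W), ‖adTransportW φ (UlevOf L m (n + 1) U j) b w‖ ≤ ‖w‖)
        (_hεg : ∀ j < n + 1, εU j ≤ α * ϱ ^ j) (_hAQ : ∑ j ∈ Finset.range (n + 1), αU j ≤ AQ)
        (hpos' : ∀ x : SiteL2K ℂ d (towerP L m (n + 1)) c₀ W, x ≠ 0 → 0 < RCLike.re ⟪x, laplacePrimeAk L m n φ η U a' (c₁ := c₁) x⟫_ℂ)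
        (hpos : ∀ x : BondL2K ℂ d (towerP L m (n + 1)) c₀ W, x ≠ 0 →
          0 < RCLike.re ⟪x, laplaceAk L m n φ η U hL αU hα1 hU1 hreg τ (c₀ := c₀) (c₁ := c₁) a x⟫_ℂ)
        (hposπ : ∀ x : BondL2K ℂ d (towerP L m (n + 1)) c₀ W, x ≠ 0 →
          0 < RCLike.re ⟪x, laplaceAkPi L m n φ τ η U a' hpos' hL αU hα1 hU1 hreg (c₁ := c₁) a x⟫_ℂ)
        (_hc₀ : c₀ = η ^ d)
        (_hJ : ∀ (μ : Fin d) (y : TSite d (towerP L m (n + 1))),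
          ‖B9Eq39Adjoint.J (fun μ => B9Eq33CovDerivVector.shiftEquiv μ) (fun μ y => U (y, μ)) η μ y‖ ≤ α)
        (v : TSite d m) (f : BondL2K ℂ d (towerP L m (n + 1)) c₀ W) (F : ℝ)
        (_hfv : ∀ b, blockCoord (L ^ (n + 1)) m (siteCast (towerP_eq_fineP_pow L m (n + 1)) (bpos b)) ≠ v →
          WL2.equiv ℂ (fun _ : Bond d (towerP L m (n + 1)) => c₀) W f b = 0)
        (_hfF : ∀ b, ‖WL2.equiv ℂ (fun _ : Bond d (towerP L m (n + 1)) => c₀) W f b‖ ≤ F) (μ : Fin d) (b : Bond d (towerP L m (n + 1)))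
        (y : TSite d (towerP L m (n + 1))),
        ‖WL2.equiv ℂ (fun _ : Bond d (towerP L m (n + 1)) => c₀) W (G1LatticeK hposπ f - G1k L m n φ η U hL αU hα1 hU1 hreg τ (c₀ := c₀) (c₁ := c₁) hpos f) b‖ ≤
            α * B * Real.exp (-(δ * tdist m (blockCoord (L ^ (n + 1)) m (siteCast (towerP_eq_fineP_pow L m (n + 1)) (bpos b))) v)) * F ∧
          ‖WL2.equiv ℂ (fun _ : TSite d (towerP L m (n + 1)) => c₀) W (covDivL2K ℂ c₀ ((η : ℂ))⁻¹ (adTransportW φ fun bb => (U bb)⁻¹)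
              (G1LatticeK hposπ f) - covDivL2K ℂ c₀ ((η : ℂ))⁻¹ (adTransportW φ fun bb => (U bb)⁻¹) (G1k L m n φ η U hL αU hα1 hU1 hreg τ (c₀ := c₀) (c₁ := c₁) hpos f)) y‖ ≤
            α * B * Real.exp (-(δ * tdist m (blockCoord (L ^ (n + 1)) m (siteCast (towerP_eq_fineP_pow L m (n + 1)) y)) v)) * F ∧
          ‖WL2.equiv ℂ (fun _ : Bond d (towerP L m (n + 1)) => c₀) W (covDerivL2K ℂ c₀ ((η : ℂ))⁻¹ (adTransportW φ U)
              ((WL2.equiv ℂ (fun _ : TSite d (towerP L m (n + 1)) => c₀) W).symm fun y' =>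
                WL2.equiv ℂ (fun _ : Bond d (towerP L m (n + 1)) => c₀) W (G1LatticeK hposπ f - G1k L m n φ η U hL αU hα1 hU1 hreg τ (c₀ := c₀) (c₁ := c₁) hpos f) (y', μ))) b‖ ≤
            α * B * Real.exp (-(δ * tdist m (blockCoord (L ^ (n + 1)) m (siteCast (towerP_eq_fineP_pow L m (n + 1)) (btgt b))) v)) * F ∧
          ‖covGrad ((η : ℂ))⁻¹ (adTransportW φ U) (WL2.equiv ℂ (fun _ : Bond d (towerP L m (n + 1)) => c₀) W (G1LatticeK hposπ f - G1k L m n φ η U hL αU hα1 hU1 hreg τ (c₀ := c₀) (c₁ := c₁) hpos f)) (b, μ)‖ ≤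
            α * B * Real.exp (-(δ * tdist m (blockCoord (L ^ (n + 1)) m (siteCast (towerP_eq_fineP_pow L m (n + 1)) (btgt b))) v)) * F := by
  classical
  -- the six `∃`-first suppliers
  obtain ⟨αV, BV, δV, hαV, hBV, hδV, HV⟩ := exists_local_letter_G1k hd L hL hL3 φ hMφ hMφ' hφ hφ' hstar ha ha' hϱ0 hϱ1 τ hτ hCτ hτm hMτ hρw hτ₁ hτ₂ hφτ AQ
  obtain ⟨αS, BS, δS, hαS, hBS, hδS, HS⟩ := exists_divergence_row_G1k hd L hL hL3 φ hMφ hMφ' hφ hφ' hstar ha ha' hϱ0 hϱ1 τ hτ hCτ hτm hMτ hρw hτ₁ hτ₂ hφτ AQ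
  obtain ⟨αX, BXg, δX, hαX, hBXg, hδX, HX⟩ := exists_local_gradLetter_G1k hd L hL hL3 φ hMφ hMφ' hφ hφ' hstar ha ha' hϱ0 hϱ1 τ hτ hCτ hτm hMτ hρw hτ₁ hτ₂ hφτ AQ
  obtain ⟨αP, BP, δP, hαP, hBP, hδP, HP⟩ := exists_local_letters_GpOfUk_RofUk hd L hL hL3 φ hMφ hMφ' hφ hφ' ha ha' hϱ0 hϱ1 τ hτ hCτ hMτ hρw hτ₁ hτ₂ hφτ AQ
  obtain ⟨α3, B3, δ3, hα3, hB3, hδ3, H3⟩ := exists_local_gradLetter_GpRk hd L hL hL3 φ hMφ hMφ' hφ hφ' ha ha' hϱ0 hϱ1 τ hτ hCτ hMτ hρw hτ₁ hτ₂ hφτ AQ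
  obtain ⟨α4, B4, δ4, hα4, hB4, hδ4, H4⟩ := exists_local_gradLetter_RkGp hd L hL hL3 φ hMφ hMφ' hφ hφ' ha ha' hϱ0 hϱ1 τ hτ hCτ hMτ hρw hτ₁ hτ₂ hφτ AQ
  -- one window, one rate, the constants of §1
  obtain ⟨κ₀, hκ₀d⟩ : ∃ κ₀ : ℝ, κ₀ = min (min (min δV δS) (min δX δP)) (min δ3 δ4) := ⟨_, rfl⟩
  have hκ₀ : 0 < κ₀ := by rw [hκ₀d]; exact lt_min (lt_min (lt_min hδV hδS) (lt_min hδX hδP)) (lt_min hδ3 hδ4)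
  have hκV : κ₀ ≤ δV := by rw [hκ₀d]; exact ((min_le_left _ _).trans (min_le_left _ _)).trans (min_le_left _ _)
  have hκS : κ₀ ≤ δS := by rw [hκ₀d]; exact ((min_le_left _ _).trans (min_le_left _ _)).trans (min_le_right _ _)
  have hκX : κ₀ ≤ δX := by rw [hκ₀d]; exact ((min_le_left _ _).trans (min_le_right _ _)).trans (min_le_left _ _)
  have hκP : κ₀ ≤ δP := by rw [hκ₀d]; exact ((min_le_left _ _).trans (min_le_right _ _)).trans (min_le_right _ _)
  have hκ3 : κ₀ ≤ δ3 := by rw [hκ₀d]; exact (min_le_right _ _).trans (min_le_left _ _)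
  have hκ4 : κ₀ ≤ δ4 := by rw [hκ₀d]; exact (min_le_right _ _).trans (min_le_right _ _)
  obtain ⟨αm, hαmd⟩ : ∃ αm : ℝ, αm = min (min (min αV αS) (min αX αP)) (min α3 α4) := ⟨_, rfl⟩
  have hαm : 0 < αm := by rw [hαmd]; exact lt_min (lt_min (lt_min hαV hαS) (lt_min hαX hαP)) (lt_min hα3 hα4)
  have hmV : αm ≤ αV := by rw [hαmd]; exact ((min_le_left _ _).trans (min_le_left _ _)).trans (min_le_left _ _)
  have hmS : αm ≤ αS := by rw [hαmd]; exact ((min_le_left _ _).trans (min_le_left _ _)).trans (min_le_right _ _)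
  have hmX : αm ≤ αX := by rw [hαmd]; exact ((min_le_left _ _).trans (min_le_right _ _)).trans (min_le_left _ _)
  have hmP : αm ≤ αP := by rw [hαmd]; exact ((min_le_left _ _).trans (min_le_right _ _)).trans (min_le_right _ _)
  have hm3 : αm ≤ α3 := by rw [hαmd]; exact (min_le_right _ _).trans (min_le_left _ _)
  have hm4 : αm ≤ α4 := by rw [hαmd]; exact (min_le_right _ _).trans (min_le_right _ _)
  have hK₂ : 0 ≤ latticeConst d (κ₀ / 2) := latticeConst_nonneg d (by linarith)
  have hK : 0 ≤ latticeConst d (κ₀ / 4) := latticeConst_nonneg d (by linarith)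
  have hK' : 0 ≤ latticeConst d (κ₀ / 8) := latticeConst_nonneg d (by linarith)
  obtain ⟨Q, hQ⟩ : ∃ Q : ℝ, Q = 2 * Mφ * Mφ' * Real.exp κ₀ * BS * (BP * BP * latticeConst d (κ₀ / 2)) * latticeConst d (κ₀ / 4) ^ 2 +
      2 * d * Mφ * Mφ' * Real.exp κ₀ * (B4 * Real.exp (κ₀ * 1)) * (BV + BS * (B3 * Real.exp (κ₀ * 1)) * latticeConst d (κ₀ / 4)) *
        latticeConst d (κ₀ / 4) ^ 2 := ⟨_, rfl⟩
  have hQ0 : 0 ≤ Q := by rw [hQ]; positivity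
  obtain ⟨α₁, hα₁d⟩ : ∃ α₁ : ℝ, α₁ = min αm (1 / (2 * (Q * latticeConst d (κ₀ / 8) * latticeConst d (κ₀ / 8) + 1))) := ⟨_, rfl⟩
  have hα₁ : 0 < α₁ := by rw [hα₁d]; exact lt_min hαm (by positivity)
  have hα₁m : α₁ ≤ αm := by rw [hα₁d]; exact min_le_left _ _
  have hα₁Q : α₁ * (Q * latticeConst d (κ₀ / 8) * latticeConst d (κ₀ / 8)) ≤ 1 / 2 := by
    have h1 : α₁ ≤ 1 / (2 * (Q * latticeConst d (κ₀ / 8) * latticeConst d (κ₀ / 8) + 1)) := by rw [hα₁d]; exact min_le_right _ _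
    have hP : 0 ≤ Q * latticeConst d (κ₀ / 8) * latticeConst d (κ₀ / 8) := by positivity
    calc α₁ * (Q * latticeConst d (κ₀ / 8) * latticeConst d (κ₀ / 8))
        ≤ 1 / (2 * (Q * latticeConst d (κ₀ / 8) * latticeConst d (κ₀ / 8) + 1)) * (Q * latticeConst d (κ₀ / 8) * latticeConst d (κ₀ / 8)) :=
          mul_le_mul_of_nonneg_right h1 hP
      _ ≤ 1 / 2 := by
          rw [div_mul_eq_mul_div, one_mul, div_le_iff₀ (by positivity)]
          nlinarith
  obtain ⟨Bs, hBs⟩ : ∃ Bs : ℝ, Bs = BV + BS + BXg := ⟨_, rfl⟩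
  have hBs0 : 0 ≤ Bs := by rw [hBs]; positivity
  refine ⟨α₁, 2 * Q * latticeConst d (κ₀ / 8) * Bs * latticeConst d (κ₀ / 8), κ₀ / 8, hα₁, by positivity, by positivity, ?_⟩
  intro n η hηL c₀ c₁ _ _ hw hρ m _ hm U αU hα0 hα1 hU1 hreg εU hεU hUε hLb α hα hαle hUst hUb hUη hpl hUgrad hRlev hεg hAQ hpos' hpos hposπ
    hc₀ hJ v f F hfv hfF μ b y
  have hη : η ≠ 0 := by
    rintro rfl
    norm_num at hηL
  have hRS : ∀ (b : Bond d (towerP L m (n + 1))) (v u : W), ⟪adTransportW φ U b v, u⟫_ℂ = ⟪v, adTransportW φ (fun b => (U b)⁻¹) b u⟫_ℂ :=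
    adTransportW_adjoint φ τ hτ₂ hUst hφτ
  have hF0 : 0 ≤ F := (norm_nonneg _).trans (hfF b)
  have hδ0 := tdist_nonneg m
  have hαV' : α ≤ αV := hαle.trans (hα₁m.trans hmV)
  have hαS' : α ≤ αS := hαle.trans (hα₁m.trans hmS)
  have hαX' : α ≤ αX := hαle.trans (hα₁m.trans hmX)
  have hαP' : α ≤ αP := hαle.trans (hα₁m.trans hmP)
  have hα3' : α ≤ α3 := hαle.trans (hα₁m.trans hm3)
  have hα4' : α ≤ α4 := hαle.trans (hα₁m.trans hm4)
  -- the contraction `q·K′·K′ < 1` (`q = α·Q ≤ α₁·Q`)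
  have hqQ : (2 * Mφ * Mφ' * α * Real.exp κ₀ * BS * (BP * BP * latticeConst d (κ₀ / 2)) * latticeConst d (κ₀ / 4) ^ 2 +
        2 * d * Mφ * Mφ' * α * Real.exp κ₀ * (B4 * Real.exp (κ₀ * 1)) * (BV + BS * (B3 * Real.exp (κ₀ * 1)) * latticeConst d (κ₀ / 4)) *
          latticeConst d (κ₀ / 4) ^ 2) = α * Q := by
    rw [hQ]; ring
  have hqt : (2 * Mφ * Mφ' * α * Real.exp κ₀ * BS * (BP * BP * latticeConst d (κ₀ / 2)) * latticeConst d (κ₀ / 4) ^ 2 +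
        2 * d * Mφ * Mφ' * α * Real.exp κ₀ * (B4 * Real.exp (κ₀ * 1)) * (BV + BS * (B3 * Real.exp (κ₀ * 1)) * latticeConst d (κ₀ / 4)) *
          latticeConst d (κ₀ / 4) ^ 2) * latticeConst d (κ₀ / 8) * 1 * latticeConst d (κ₀ / 8) ≤ 1 / 2 := by
    rw [hqQ]
    calc α * Q * latticeConst d (κ₀ / 8) * 1 * latticeConst d (κ₀ / 8) = α * (Q * latticeConst d (κ₀ / 8) * latticeConst d (κ₀ / 8)) := by ring
      _ ≤ α₁ * (Q * latticeConst d (κ₀ / 8) * latticeConst d (κ₀ / 8)) := mul_le_mul_of_nonneg_right hαle (by positivity)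
      _ ≤ 1 / 2 := hα₁Q
  have hq : (2 * Mφ * Mφ' * α * Real.exp κ₀ * BS * (BP * BP * latticeConst d (κ₀ / 2)) * latticeConst d (κ₀ / 4) ^ 2 +
        2 * d * Mφ * Mφ' * α * Real.exp κ₀ * (B4 * Real.exp (κ₀ * 1)) * (BV + BS * (B3 * Real.exp (κ₀ * 1)) * latticeConst d (κ₀ / 4)) *
          latticeConst d (κ₀ / 4) ^ 2) * latticeConst d (κ₀ / 8) * 1 * latticeConst d (κ₀ / 8) < 1 := hqt.trans_lt (by norm_num)
  -- the uniform constant (difference form: the `q`-carrying summand only, `q = α·Q`)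
  have hunif : ∀ {BXr : ℝ}, 0 ≤ BXr → BXr ≤ Bs →
      0 ≤ 1 / (1 - α * Q * latticeConst d (κ₀ / 8) * 1 * latticeConst d (κ₀ / 8)) * (α * Q) * latticeConst d (κ₀ / 8) * BXr *
          latticeConst d (κ₀ / 8) ∧
        1 / (1 - α * Q * latticeConst d (κ₀ / 8) * 1 * latticeConst d (κ₀ / 8)) * (α * Q) * latticeConst d (κ₀ / 8) * BXr *
            latticeConst d (κ₀ / 8) ≤ α * (2 * Q * latticeConst d (κ₀ / 8) * Bs * latticeConst d (κ₀ / 8)) := by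
    intro BXr hBXr hBXrs
    have hqt' : α * Q * latticeConst d (κ₀ / 8) * 1 * latticeConst d (κ₀ / 8) ≤ 1 / 2 := by rw [← hqQ]; exact hqt
    have hM2 := one_div_one_sub_le_two hqt'
    have hM0 : 0 ≤ 1 / (1 - α * Q * latticeConst d (κ₀ / 8) * 1 * latticeConst d (κ₀ / 8)) := div_nonneg zero_le_one (by linarith)
    have hαQ0 : 0 ≤ α * Q := mul_nonneg hα hQ0
    refine ⟨by positivity, ?_⟩
    have hin : 0 ≤ α * (Q * latticeConst d (κ₀ / 8) * BXr * latticeConst d (κ₀ / 8)) := by positivity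
    calc 1 / (1 - α * Q * latticeConst d (κ₀ / 8) * 1 * latticeConst d (κ₀ / 8)) * (α * Q) * latticeConst d (κ₀ / 8) * BXr *
          latticeConst d (κ₀ / 8)
        = 1 / (1 - α * Q * latticeConst d (κ₀ / 8) * 1 * latticeConst d (κ₀ / 8)) * (α * (Q * latticeConst d (κ₀ / 8) * BXr *
          latticeConst d (κ₀ / 8))) := by ring
      _ ≤ 2 * (α * (Q * latticeConst d (κ₀ / 8) * Bs * latticeConst d (κ₀ / 8))) := by
          gcongr
      _ = α * (2 * Q * latticeConst d (κ₀ / 8) * Bs * latticeConst d (κ₀ / 8)) := by ring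
  -- the slice derivative as a CLM (output blocks `Π∘b₊`), the divergence as a CLM
  obtain ⟨Xμ, hXμ⟩ : ∃ T : BondL2K ℂ d (towerP L m (n + 1)) c₀ W →L[ℂ] BondL2K ℂ d (towerP L m (n + 1)) c₀ W,
      ∀ (u : BondL2K ℂ d (towerP L m (n + 1)) c₀ W) (b' : Bond d (towerP L m (n + 1))),
        WL2.equiv ℂ (fun _ : Bond d (towerP L m (n + 1)) => c₀) W (T u) b' =
          WL2.equiv ℂ (fun _ : Bond d (towerP L m (n + 1)) => c₀) W (covDerivL2K ℂ c₀ ((η : ℂ))⁻¹ (adTransportW φ U)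
            ((WL2.equiv ℂ (fun _ : TSite d (towerP L m (n + 1)) => c₀) W).symm fun y' =>
              WL2.equiv ℂ (fun _ : Bond d (towerP L m (n + 1)) => c₀) W u (y', μ))) b' :=
    ⟨LinearMap.toContinuousLinearMap (covDerivL2K ℂ c₀ ((η : ℂ))⁻¹ (adTransportW φ U) ∘ₗ
        (WL2.linearEquiv ℂ ℂ (fun _ : TSite d (towerP L m (n + 1)) => c₀)).symm.toLinearMap ∘ₗ
        LinearMap.funLeft ℂ W (fun y' : TSite d (towerP L m (n + 1)) => ((y', μ) : Bond d (towerP L m (n + 1)))) ∘ₗ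
        (WL2.linearEquiv ℂ ℂ (fun _ : Bond d (towerP L m (n + 1)) => c₀)).toLinearMap), fun _ _ => rfl⟩
  obtain ⟨Dsc, hDsc⟩ : ∃ T : BondL2K ℂ d (towerP L m (n + 1)) c₀ W →L[ℂ] SiteL2K ℂ d (towerP L m (n + 1)) c₀ W,
      T = LinearMap.toContinuousLinearMap (covDivL2K ℂ c₀ ((η : ℂ))⁻¹ (adTransportW φ fun bb => (U bb)⁻¹)) := ⟨_, rfl⟩
  -- §1 three times
  have T := fun {X₂ : Type} [Fintype X₂] {w₂ : X₂ → ℝ} [Fact (∀ x, 0 < w₂ x)] (π₂ : X₂ → TSite d m)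
      (X : BondL2K ℂ d (towerP L m (n + 1)) c₀ W →L[ℂ] WL2 ℂ w₂ W) {BX : ℝ} (hBX : 0 ≤ BX)
      (hXG₀ : ∀ (v : TSite d m) (f : BondL2K ℂ d (towerP L m (n + 1)) c₀ W) (F : ℝ),
        (∀ b, blockCoord (L ^ (n + 1)) m (siteCast (towerP_eq_fineP_pow L m (n + 1)) (bpos b)) ≠ v →
          WL2.equiv ℂ (fun _ : Bond d (towerP L m (n + 1)) => c₀) W f b = 0) →
        (∀ b, ‖WL2.equiv ℂ (fun _ : Bond d (towerP L m (n + 1)) => c₀) W f b‖ ≤ F) →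
        ∀ x, ‖WL2.equiv ℂ w₂ W (X (G1k L m n φ η U hL αU hα1 hU1 hreg τ (c₀ := c₀) (c₁ := c₁) hpos f)) x‖ ≤
          BX * Real.exp (-(κ₀ * tdist m (π₂ x) v)) * F) (x : X₂) =>
    letter_transfer_tower_sub L m n φ τ η U hRS a' hpos' hL αU hα1 hU1 hreg a hpos hposπ hd hm π₂ X
      (B₀ := BV) (B₁ := BS) (BG := BP) (BR := BP) (B₃ := B3) (B₄ := B4) (ε := 2 * Mφ * Mφ' * α * Real.exp κ₀)
      (ε' := 2 * d * Mφ * Mφ' * α * Real.exp κ₀) (BX := BX) (κ₀ := κ₀) hBV hBS hBP hBP hB3 hB4 (by positivity) (by positivity) hBX hκ₀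
      (fun v f F hfv hfF b => (HV n η hηL c₀ c₁ hw hρ m hm U αU hα0 hα1 hU1 hreg εU hεU hUε hLb α hα hαV' hUst hUb hUη hpl hUgrad hRlev hεg hAQ
        hpos' hpos v f F hfv hfF b).trans (weaken hBV le_rfl hκV (hδ0 _ _) ((norm_nonneg _).trans (hfF b))))
      (fun v f F hfv hfF y => (HS n η hηL c₀ c₁ hw hρ m hm U αU hα0 hα1 hU1 hreg εU hεU hUε hLb α hα hαS' hUst hUb hUη hpl hUgrad hRlev hεg hAQ
        hpos' hpos v f F hfv hfF y).trans (weaken hBS le_rfl hκS (hδ0 _ _) ((norm_nonneg _).trans (hfF (y, μ)))))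
      (fun v w F hwv hwF x => (HP n η hηL c₀ c₁ hw hρ m hm U αU hα0 hα1 hU1 hreg εU hεU hUε hLb α hα hαP' hUst hUb hUη hpl hUgrad hRlev hεg hAQ
        hpos' v w F hwv hwF x).1.trans (weaken hBP le_rfl hκP (hδ0 _ _) ((norm_nonneg _).trans (hwF x))))
      (fun v w F hwv hwF x => (HP n η hηL c₀ c₁ hw hρ m hm U αU hα0 hα1 hU1 hreg εU hεU hUε hLb α hα hαP' hUst hUb hUη hpl hUgrad hRlev hεg hAQ
        hpos' v w F hwv hwF x).2.1.trans (weaken hBP le_rfl hκP (hδ0 _ _) ((norm_nonneg _).trans (hwF x))))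
      (fun v w F hwv hwF b => (H3 n η hηL c₀ c₁ hw hρ m hm U αU hα0 hα1 hU1 hreg εU hεU hUε hLb α hα hα3' hUst hUb hUη hpl hUgrad hRlev hεg hAQ
        hpos' v w F hwv hwF b).trans (weaken hB3 le_rfl hκ3 (hδ0 _ _) ((norm_nonneg _).trans (hwF (bpos b)))))
      (fun v w F hwv hwF b => (H4 n η hηL c₀ c₁ hw hρ m hm U αU hα0 hα1 hU1 hreg εU hεU hUε hLb α hα hα4' hUst hUb hUη hpl hUgrad hRlev hεg hAQ
        hpos' v w F hwv hwF b).trans (weaken hB4 le_rfl hκ4 (hδ0 _ _) ((norm_nonneg _).trans (hwF (bpos b)))))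
      (fun v s F hsv hsF b => local_hessOp_covDerivL2K_tower L m (n + 1) φ τ hτ₂ hφτ hη hUst hc₀ hUb hMφ hMφ' hφ hφ' hJ hm hκ₀.le v s F hsv hsF b)
      (fun v A F hAv hAF y => local_covDivL2K_hessOp_tower L m (n + 1) φ τ hτ₂ hφτ hη hUst hc₀ hUb hMφ hMφ' hφ hφ' hJ hm hκ₀.le v A F hAv hAF y)
      hXG₀ hq v f F hfv hfF x
  -- the value row (`X = 1`)
  have hVal := T (fun b : Bond d (towerP L m (n + 1)) => blockCoord (L ^ (n + 1)) m (siteCast (towerP_eq_fineP_pow L m (n + 1)) (bpos b)))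
    (ContinuousLinearMap.id ℂ _) hBV
    (fun v f F hfv hfF b => by
      rw [ContinuousLinearMap.coe_id', id_eq]
      exact (HV n η hηL c₀ c₁ hw hρ m hm U αU hα0 hα1 hU1 hreg εU hεU hUε hLb α hα hαV' hUst hUb hUη hpl hUgrad hRlev hεg hAQ
        hpos' hpos v f F hfv hfF b).trans (weaken hBV le_rfl hκV (hδ0 _ _) ((norm_nonneg _).trans (hfF b)))) b
  -- the divergence row (`X = D*_U`)
  have hDiv := T (fun x : TSite d (towerP L m (n + 1)) => blockCoord (L ^ (n + 1)) m (siteCast (towerP_eq_fineP_pow L m (n + 1)) x)) Dsc hBS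
    (fun v f F hfv hfF y => by
      rw [hDsc, LinearMap.coe_toContinuousLinearMap']
      exact (HS n η hηL c₀ c₁ hw hρ m hm U αU hα0 hα1 hU1 hreg εU hεU hUε hLb α hα hαS' hUst hUb hUη hpl hUgrad hRlev hεg hAQ
        hpos' hpos v f F hfv hfF y).trans (weaken hBS le_rfl hκS (hδ0 _ _) ((norm_nonneg _).trans (hfF (y, μ))))) y
  -- the gradient row (`X =` the slice derivative, output blocks `Π∘b₊`)
  have hGrad := T (fun b : Bond d (towerP L m (n + 1)) => blockCoord (L ^ (n + 1)) m (siteCast (towerP_eq_fineP_pow L m (n + 1)) (btgt b)))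
    Xμ hBXg
    (fun v f F hfv hfF b => by
      rw [hXμ]
      exact (HX n η hηL c₀ c₁ hw hρ m hm U αU hα0 hα1 hU1 hreg εU hεU hUε hLb α hα hαX' hUst hUb hUη hpl hUgrad hRlev hεg hAQ
        hpos' hpos v f F hfv hfF μ b).1.trans (weaken hBXg le_rfl hκX (hδ0 _ _) ((norm_nonneg _).trans (hfF b)))) b
  rw [ContinuousLinearMap.coe_id', id_eq, id_eq, hqQ] at hVal
  rw [hDsc, LinearMap.coe_toContinuousLinearMap', hqQ] at hDiv
  rw [← map_sub, hXμ, hqQ] at hGrad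
  have hBV' : BV ≤ Bs := by rw [hBs]; linarith
  have hBS' : BS ≤ Bs := by rw [hBs]; linarith
  have hBXg' : BXg ≤ Bs := by rw [hBs]; linarith
  have e₁ := hVal.trans (weaken (hunif hBV hBV').1 (hunif hBV hBV').2 le_rfl (hδ0 _ _) hF0)
  have e₂ := hDiv.trans (weaken (hunif hBS hBS').1 (hunif hBS hBS').2 le_rfl (hδ0 _ _) hF0)
  have e₃ := hGrad.trans (weaken (hunif hBXg hBXg').1 (hunif hBXg hBXg').2 le_rfl (hδ0 _ _) hF0)
  exact ⟨e₁, e₂, e₃, norm_covGrad_apply_le_of_slice _ _ _ b μ e₃⟩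

end AllHeights


end Literature.MathematicalPhysics.QuantumFieldTheory.Balaban1983to89.B9Eq3130GtildeMinusG1kGradRowsClosed

end
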